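import Mathlib
import HarnessLib
import Summits.ResolutionOfSingularities.ResolutionOfSingularities.Theorems.WildQuotientsWildQuotientResolutionS1aGameFrame
import Summits.ResolutionOfSingularities.ResolutionOfSingularities.Theorems.WildQuotientsWildQuotientResolutionS1aGameFrameWFFrom

/-!
# S1a — (T0) TERMINAL RECOGNITION: the bad locus `Z(M)` of a `G`-model and the first measure component `ν₁`

[OURS · L1 W4.5c · lead-1 g6, after plan-1 g11's signature sheet `L/w45c/W45cT0Signatures.lean` 47656d5934225f6f
(STRATEGY-DESIGN v2 §4–§5)] — NOT statements of the manuscript; counted 0; AI-level work, weaker than expert review.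
Crux stmt-ResolutionOfSingularities-17941 (`WildQuotients.CyclicQuotientFourfolds`), line `s1a-logminvertex` v5, stub
`stub_strategy` (ladder rung T0).

The BAD LOCUS `Z(M)` of a `G`-model = the negation of the `Terminal` clause, pointwise: `Terminal ↔ Z = ∅`
(`terminal_iff_badLocus_eq_empty`); `Z` is closed (`isClosed_badLocus`: goodness is an open condition) and `G`-stable
(`aut_base_mem_badLocus_iff`, `preimage_badLocus`); `ν₁ := topologicalKrullDim Z(M) : WithBot ℕ∞` (`nu1`) is `⊥` iff the
model is terminal (`nu1_eq_bot_iff`); on a quasi-compact model `Z` has finitely many irreducible components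
(`finite_irreducibleComponents_badLocus`). The proposed measure carrier `MuHat = WithBot ℕ∞ ×ₗ ℕ ×ₗ ℕ ×ₗ ℕ ×ₗ ℕ` is
well-founded by instance and is accepted by `StrategyWFFrom` (`strategyWFFrom_of_muHat`).
-/

set_option linter.dupNamespace false

noncomputable section

open CategoryTheory AlgebraicGeometry TopologicalSpace
open Literature.AlgebraicGeometry.Resolution Literature.AlgebraicGeometry.RelativeSpec
open Summit.ResolutionOfSingularities.ResolutionOfSingularities.Theorems.WildQuotientResolution.S1
open Summit.ResolutionOfSingularities.ResolutionOfSingularities.Theorems.WildQuotientResolution.S1.NodeAtlas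

namespace Summit.ResolutionOfSingularities.ResolutionOfSingularities.Theorems.WildQuotientResolution.S1.GameFrame.GModel

variable {p : ℕ} {X' X₁ : Scheme.{0}} {q : X' ⟶ X₁} {G : Type} [Group G] {ρ : G →* Aut X'} {g₀ : G}

/-- `M` is GOOD at `v`: the `Terminal` clause at the point `v` — a `G`-stable affine open through `v`, affine over the
base, whose ring of invariants is a tame root chart. [OURS · L1 W4.5c] -/
def IsGoodAt (M : GModel p q G ρ g₀) (v : M.V) : Prop :=
  ∃ O : M.act.StableAffineOpens, v ∈ O.1 ∧ IsAffineOpen O.1 ∧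
    IsTameRootChart ↥((M.act.restrict O.1 O.2.1).invariantsRing ⊤)

/-- **The bad locus `Z(M)`** — the points with no good `G`-stable affine neighbourhood. [OURS · L1 W4.5c] -/
def badLocus (M : GModel p q G ρ g₀) : Set M.V := {v | ¬ M.IsGoodAt v}

/-- (T0a) `Terminal ↔ Z = ∅` — definitional. -/
theorem terminal_iff_badLocus_eq_empty (M : GModel p q G ρ g₀) : M.Terminal ↔ M.badLocus = ∅ := by
  simp only [Terminal, badLocus, IsGoodAt, Set.eq_empty_iff_forall_notMem, Set.mem_setOf_eq, not_not]

/-- Membership in the bad locus. -/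
theorem mem_badLocus_iff (M : GModel p q G ρ g₀) (v : M.V) : v ∈ M.badLocus ↔ ¬ M.IsGoodAt v := Iff.rfl

/-- Goodness is an open condition (the witnessing open witnesses for all its points). -/
theorem isOpen_setOf_isGoodAt (M : GModel p q G ρ g₀) : IsOpen {v | M.IsGoodAt v} := by
  rw [isOpen_iff_forall_mem_open]
  rintro v ⟨O, hv, hO, hT⟩
  exact ⟨O.1, fun w hw => ⟨O, hw, hO, hT⟩, O.1.isOpen, hv⟩

/-- (T0a′) `Z(M)` is closed. -/
theorem isClosed_badLocus (M : GModel p q G ρ g₀) : IsClosed M.badLocus := by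
  simpa only [badLocus, ← isOpen_compl_iff, Set.compl_setOf, not_not] using M.isOpen_setOf_isGoodAt

/-- Goodness is `G`-invariant (the witnessing opens are `G`-stable). -/
theorem isGoodAt_aut_base_iff (M : GModel p q G ρ g₀) (g : G) (v : M.V) :
    M.IsGoodAt ((M.act.aut g).hom.base v) ↔ M.IsGoodAt v := by
  constructor
  · rintro ⟨O, hv, hO, hT⟩
    have hv' : v ∈ (M.act.aut g).hom ⁻¹ᵁ O.1 := hv
    rw [O.2.1 g] at hv'
    exact ⟨O, hv', hO, hT⟩
  · rintro ⟨O, hv, hO, hT⟩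
    have hv' : v ∈ (M.act.aut g).hom ⁻¹ᵁ O.1 := by rw [O.2.1 g]; exact hv
    exact ⟨O, hv', hO, hT⟩

/-- (T0a″) `Z(M)` is `G`-stable. -/
theorem aut_base_mem_badLocus_iff (M : GModel p q G ρ g₀) (g : G) (v : M.V) :
    (M.act.aut g).hom.base v ∈ M.badLocus ↔ v ∈ M.badLocus := by
  simp only [mem_badLocus_iff, isGoodAt_aut_base_iff]

/-- (T0a″, set form) the preimage of `Z(M)` under each `g` is `Z(M)`. -/
theorem preimage_badLocus (M : GModel p q G ρ g₀) (g : G) :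
    (fun v => (M.act.aut g).hom.base v) ⁻¹' M.badLocus = M.badLocus :=
  Set.ext fun v => M.aut_base_mem_badLocus_iff g v

/-- **ν₁** := the (topological Krull) dimension of the bad locus, in `WithBot ℕ∞` (`⊥` iff terminal). [OURS · L1 W4.5c] -/
def nu1 (M : GModel p q G ρ g₀) : WithBot ℕ∞ := topologicalKrullDim M.badLocus

/-- (T0b) `ν₁ = ⊥` iff the model is terminal. -/
theorem nu1_eq_bot_iff (M : GModel p q G ρ g₀) : M.nu1 = ⊥ ↔ M.Terminal := by
  rw [terminal_iff_badLocus_eq_empty, nu1, topologicalKrullDim, Order.krullDim_eq_bot_iff]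
  constructor
  · intro h
    rw [Set.eq_empty_iff_forall_notMem]
    intro v hv
    exact h.elim ⟨closure {(⟨v, hv⟩ : M.badLocus)}, isIrreducible_singleton.closure, isClosed_closure⟩
  · intro h
    refine ⟨fun s => ?_⟩
    obtain ⟨⟨v, hv⟩, -⟩ := s.isIrreducible'.nonempty
    rw [h] at hv
    exact hv

/-- `ν₁ ≠ ⊥` iff the model is NOT terminal (the case in which a strategy must move). -/
theorem nu1_ne_bot_iff (M : GModel p q G ρ g₀) : M.nu1 ≠ ⊥ ↔ ¬ M.Terminal :=
  not_congr M.nu1_eq_bot_iff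

/-- The bad locus of a quasi-compact model is a Noetherian topological space (`V` is locally Noetherian). -/
theorem noetherianSpace_badLocus (M : GModel p q G ρ g₀) [CompactSpace M.V] : NoetherianSpace M.badLocus := by
  haveI := M.isLocallyNoetherian
  haveI : IsNoetherian M.V := {}
  exact Topology.IsInducing.subtypeVal.noetherianSpace

/-- (T0d) On a quasi-compact model the bad locus has finitely many irreducible components. -/
theorem finite_irreducibleComponents_badLocus (M : GModel p q G ρ g₀) [CompactSpace M.V] :
    (irreducibleComponents M.badLocus).Finite := by
  haveI := M.noetherianSpace_badLocus
  exact NoetherianSpace.finite_irreducibleComponents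

/-- `ν₁` is bounded by the dimension of the model. -/
theorem nu1_le (M : GModel p q G ρ g₀) : M.nu1 ≤ topologicalKrullDim M.V :=
  topologicalKrullDim_subspace_le M.V M.badLocus

/-- **The measure carrier proposed for μ̂ v2** `(ν₁, d, e, code ν₂rev, ν₄)`: lexicographic, well-founded by instance.
[OURS · L1 W4.5c] -/
abbrev MuHat : Type := WithBot ℕ∞ ×ₗ ℕ ×ₗ ℕ ×ₗ ℕ ×ₗ ℕ

/-- `MuHat` is well-founded (instance check). -/
example : WellFoundedLT MuHat := inferInstance

/-- **`StrategyWFFrom` from a `MuHat`-valued measure**: the registered definition accepts the carrier — a strategy is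
an invariant `P ∋ M₀` and, at every non-terminal `P`-model, an admissible centre all of whose moves stay in `P` and
decrease `μ : GModel → MuHat`. -/
theorem strategyWFFrom_of_muHat (M₀ : GModel p q G ρ g₀) (μ : GModel p q G ρ g₀ → MuHat)
    (P : GModel p q G ρ g₀ → Prop) (hP : P M₀)
    (h : ∀ M : GModel p q G ρ g₀, P M → ¬ M.Terminal →
      ∃ (𝒦 : ReesFiltration M.V) (d : ℕ), IsAdmissibleCentre p M.act g₀ 𝒦 d ∧
        ∀ M' : GModel p q G ρ g₀, M.IsMoveOf M' 𝒦 d → P M' ∧ μ M' < μ M) :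
    StrategyWFFrom p q G ρ g₀ M₀ :=
  ⟨MuHat, inferInstance, inferInstance, μ, P, hP, h⟩

end Summit.ResolutionOfSingularities.ResolutionOfSingularities.Theorems.WildQuotientResolution.S1.GameFrame.GModel

end
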